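import Summits.BirchSwinnertonDyer.BirchSwinnertonDyer.Theorems.KimAtThreePortSharedC2Supply
import HarnessLib

/-!
# (C2₂) — the CERTIFICATE SUPPLY on the ADDITIVE-DEFECT rows (`3 ∣ c₃ ∨ 3 ∣ c_P`) is a THEOREM:
# w2-c3 gen 4's class-wide unit minus symbol + kim3's row converter, selector-free
# (cell `bsd-addord`, seat w2-c3 gen 5; route W2 `KimAtThreeKolyvagin`, crux 19076, off-stratum items
# 19562 / 19599 / 19679 additive-defect rows — acc6's `CERTSUPPLY₂` binder)

HONEST FRAMING: theorems only (no definition, no named fact, no `sorry`); closes nothing; nothing booked;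
BSD is not proved by any of this.

## What

w2-c3 gen 4 (p457409) proved kim3's (C2′) class-wide on the Kato stratum: `unitMinusSymbol_row` needs
ONLY `surj(3)`, `3 ∣ N` and a parametrisation datum `P` (Manin relation + `im Λ_f = ℤΩ⁻/2` +
Chebotarev) — no hypothesis on `c₃`, on `E(ℚ₃)[3]` or on the Manin constant; kim3's
`certSupply_row_of_unitMinusSymbol` (p451219) turns one such certificate into Kato's auxiliary cusp datum
`(c, d, a, A, d′, aM)` with unit value certificates, needing only `9 ∣ N`.  Hence the certificate supply
holds for EVERY `W` additive at `3` with surjective mod-`3` image at `N = N_W`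
(`certSupply_of_addv`), in particular on the additive-DEFECT selector of acc6's PORT₂ ENDs
(`certSupply_defectRows` = the binder `CERTSUPPLY₂` of
`KimAtThreeShallowEqDeepOffStratumAdditiveDefectOfZetaBody` VERBATIM).  With the seat's THEOREM D-u
(`KimAtThreeDeepUpperKolyvaginPair`, no `hbad`) this leaves the additive-defect rows of 19562 / 19599 /
19679 on the fine Kato package (C1₂) ALONE.

References: kim3 memo KIM3-W2-PORT-g10 §3; w2-c3 memo W2C3-C2PRIME-CLASSWIDE-g4; [Kato2004Asterisque]
Ex. 13.3, Thm. 6.6 (1); [TateGCFT1967] §2.4.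
-/

noncomputable section

-- the cell's Theorems namespace repeats the summit name by design (D-0017)
set_option linter.dupNamespace false

open scoped NumberField TensorProduct Classical
open Field Finset IsDedekindDomain NumberField WeierstrassCurve Rat.HeightOneSpectrum
open Literature.NumberTheory.GaloisRepresentations Literature.NumberTheory.GaloisCohomology
open Literature.NumberTheory.EllipticCurves Literature.NumberTheory.EllipticCurves.ModularForms
open Literature.NumberTheory.EllipticCurves.Rank1Residual
open Literature.NumberTheory.EllipticCurves.Kato2004
open Literature.NumberTheory.EllipticCurves.Kato2004.EulerSystemValues
open Summit.BirchSwinnertonDyer.Rank1Residual.GaloisImage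
open Summit.BirchSwinnertonDyer.BirchSwinnertonDyer.Theorems

namespace Summit.BirchSwinnertonDyer.BirchSwinnertonDyer.Theorems.KimAtThreeDeepUpperCertSupplyDefect

/-- **Kato's auxiliary cusp datum with unit value certificates exists for EVERY `W` additive at `3` with
surjective mod-`3` image, at any parametrisation datum of conductor level** — no hypothesis on `c₃`,
`E(ℚ₃)[3]` or the Manin constant (gen 4 `unitMinusSymbol_row` + kim3 `certSupply_row_of_unitMinusSymbol`;
`9 ∣ N_W` from `Addv W 3`).  [cite: Kato2004Asterisque, Ex. 13.3 (pp. 224–225) and Thm. 6.6 (1) (p. 163)]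
[cite: TateGCFT1967, §2.4 (Tchebotarev density theorem)] -/
theorem certSupply_of_addv (W : WeierstrassCurve ℚ) [W.IsElliptic] [W.IsGloballyMinimal]
    (hs : W.HasSurjectiveModNGaloisRep (3 : ℕ))
    (hadd : haveI : Fact (Nat.Prime 3) := ⟨Nat.prime_three⟩; Addv W 3)
    {N : ℕ} [NeZero N] (P : ModularParametrizationData W N) (hN : N = W.conductorNorm ℤ) :
    ∃ (c d a : ℤ) (A : ℕ) (d' : ℤ) (aM : ℕ → ℤ),
      0 < A ∧ Int.gcd c (6 * 3 * A) = 1 ∧ Int.gcd d (6 * 3 * N) = 1 ∧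
      (∀ q : ℕ, q.Prime → q ≡ 1 [MOD 3] → ¬ q ∣ 2 * c.natAbs * d.natAbs * A) ∧
      Int.gcd (c * d) A = 1 ∧ d * d' ≡ 1 [ZMOD (A : ℤ)] ∧ Nat.Coprime A N ∧
      (∀ q ∈ (3 * A).primeFactors, cuspCoeff P.f q = aM q) ∧
      (∏ q ∈ (3 * A).primeFactors,
          (1 - (aM q : ℚ) / q + (if q ∣ N then 0 else (1 / q : ℚ))) ≠ 0) ∧
      padicValRat 3 (∏ q ∈ (3 * A).primeFactors,
          (1 - (aM q : ℚ) / q + (if q ∣ N then 0 else (1 / q : ℚ)))) = 0 ∧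
      ((c : ℚ) ^ 2 * (d : ℚ) ^ 2 * ratMinusSymbol P.f ((a : ℚ) / A) -
          (c : ℚ) * (d : ℚ) ^ 2 * ratMinusSymbol P.f ((a * c : ℚ) / A) -
          (c : ℚ) ^ 2 * (d : ℚ) * ratMinusSymbol P.f ((a * d' : ℚ) / A) +
          (c : ℚ) * (d : ℚ) * ratMinusSymbol P.f ((a * c * d' : ℚ) / A) ≠ 0) ∧
      padicValRat 3 ((c : ℚ) ^ 2 * (d : ℚ) ^ 2 * ratMinusSymbol P.f ((a : ℚ) / A) -
          (c : ℚ) * (d : ℚ) ^ 2 * ratMinusSymbol P.f ((a * c : ℚ) / A) -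
          (c : ℚ) ^ 2 * (d : ℚ) * ratMinusSymbol P.f ((a * d' : ℚ) / A) +
          (c : ℚ) * (d : ℚ) * ratMinusSymbol P.f ((a * c * d' : ℚ) / A)) = 0 := by
  have h9 : 3 ^ 2 ∣ N := hN ▸ KimAtThreeKolyvaginPortShared.sq_dvd_conductorNorm_of_addv W hadd
  have h3N : 3 ∣ N := dvd_trans (dvd_pow_self 3 two_ne_zero) h9
  obtain ⟨q, n, t, a₀, hq, hq3, hqN, hn, ht, h3t, hX0, hX⟩ :=
    KimAtThreePortSharedC2Supply.unitMinusSymbol_row W hs h3N P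
  exact KimAtThreeKolyvaginPortSharedCert.certSupply_row_of_unitMinusSymbol W P h9 hq hq3 hqN hn ht h3t
    hX0 hX

/-- **(C2₂) the CERTIFICATE SUPPLY on the additive-defect rows** — acc6's binder `CERTSUPPLY₂` of
`KimAtThreeShallowEqDeepOffStratumAdditiveDefectOfZetaBody` VERBATIM (the torsion, lattice and defect
antecedents are not used). [cite: Kato2004Asterisque, Ex. 13.3 (pp. 224–225) and Thm. 6.6 (1) (p. 163)]
[cite: TateGCFT1967, §2.4 (Tchebotarev density theorem)] -/
theorem certSupply_defectRows :
  ∀ (W : WeierstrassCurve ℚ) [W.IsElliptic] [W.IsGloballyMinimal],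
    (∀ m : ℕ, W.HasSurjectiveModNGaloisRep (3 ^ m : ℕ)) →
    (haveI : Fact (Nat.Prime 3) := ⟨Nat.prime_three⟩; Addv W 3) →
    Nat.card {Q : (W.baseChange ℚ_[3]).toAffine.Point // (3 : ℕ) • Q = 0} = 1 →
    ∀ {N : ℕ} [NeZero N] (P : ModularParametrizationData W N), N = W.conductorNorm ℤ →
      (∀ z ∈ P.L.lattice, ∃ w ∈ periodLattice P.f, z = P.c * w) →
      (3 ∣ (W.baseChange ℚ_[3]).localTamagawaNumber ℤ_[3] ∨ (3 : ℤ) ∣ P.maninConstant) →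
      ∃ (c d a : ℤ) (A : ℕ) (d' : ℤ) (aM : ℕ → ℤ),
        0 < A ∧ Int.gcd c (6 * 3 * A) = 1 ∧ Int.gcd d (6 * 3 * N) = 1 ∧
        (∀ q : ℕ, q.Prime → q ≡ 1 [MOD 3] → ¬ q ∣ 2 * c.natAbs * d.natAbs * A) ∧
        Int.gcd (c * d) A = 1 ∧ d * d' ≡ 1 [ZMOD (A : ℤ)] ∧ Nat.Coprime A N ∧
        (∀ q ∈ (3 * A).primeFactors, cuspCoeff P.f q = aM q) ∧
        (∏ q ∈ (3 * A).primeFactors,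
            (1 - (aM q : ℚ) / q + (if q ∣ N then 0 else (1 / q : ℚ))) ≠ 0) ∧
        padicValRat 3 (∏ q ∈ (3 * A).primeFactors,
            (1 - (aM q : ℚ) / q + (if q ∣ N then 0 else (1 / q : ℚ)))) = 0 ∧
        ((c : ℚ) ^ 2 * (d : ℚ) ^ 2 * ratMinusSymbol P.f ((a : ℚ) / A) -
            (c : ℚ) * (d : ℚ) ^ 2 * ratMinusSymbol P.f ((a * c : ℚ) / A) -
            (c : ℚ) ^ 2 * (d : ℚ) * ratMinusSymbol P.f ((a * d' : ℚ) / A) +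
            (c : ℚ) * (d : ℚ) * ratMinusSymbol P.f ((a * c * d' : ℚ) / A) ≠ 0) ∧
        padicValRat 3 ((c : ℚ) ^ 2 * (d : ℚ) ^ 2 * ratMinusSymbol P.f ((a : ℚ) / A) -
            (c : ℚ) * (d : ℚ) ^ 2 * ratMinusSymbol P.f ((a * c : ℚ) / A) -
            (c : ℚ) ^ 2 * (d : ℚ) * ratMinusSymbol P.f ((a * d' : ℚ) / A) +
            (c : ℚ) * (d : ℚ) * ratMinusSymbol P.f ((a * c * d' : ℚ) / A)) = 0 := by
  intro W _ _ htow hadd _ N _ P hN _ _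
  exact certSupply_of_addv W (by simpa using htow 1) hadd P hN

end Summit.BirchSwinnertonDyer.BirchSwinnertonDyer.Theorems.KimAtThreeDeepUpperCertSupplyDefect

end
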